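import Mathlib
import Summits.KontsevichZagierPeriods.Zeta5Search.ThirdOrderNorms
import Summits.KontsevichZagierPeriods.Zeta5Search.ThirdOrderLivePair
import Summits.KontsevichZagierPeriods.Zeta5Search.ThirdDigitVTransport
import Summits.KontsevichZagierPeriods.Zeta5Search.CollinearityDigits
import Summits.KontsevichZagierPeriods.Zeta5Search.CollinearityOrbits
import HarnessLib

/-!
# ζ(5) search — the RAISE PAIR IDENTITY to relative order `p²` (P1 of gen-2 g10's THEOREM A⁗, REPORT-gen2-g10 §6.4)

Cell `pub-zeta5` (HONEST FRAMING: systematic search; no irrationality claim unless certified), typer seat generation 12.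
For a pole class `y` of exponent `m+1` (`m+1 ≤ −2`) whose type list is a single raise of the palindrome `T`, or which is the
odd-centre class of list `T`, and its conjugate `ȳ` (`Ω = W/(−p)^{m+3}`, `N = V/(−p)^m`, `τ(T) = (τ_W, τ_V)`):
**`(Ω,N)_y + (Ω,N)_ȳ ≡ a_y · τ(T) (mod p³)`** with ONE scalar `a_y`, `‖a_y‖ ≤ p⁻¹` (`raise_pair₃`;
`a_y = −pĝ_y(1 − pκφ_y)`, `κ = L−k`, `L+2`, `−1` for `T+δ_k`, `1::T`, `T++[1]`; `a_y = −pĝ_y` for the odd-centre class).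
Ingredients: (W2)/(V2) in the normalisation of A⁗ (`sub3W_norm`, `sub3V_norm`), the live pair at first and second order
(`live_pair`, `live_pair₂`), `ĝ_ȳ ≡ ĝ_y(1 − pMφ_y) (mod p²)` at odd exponent (`gHat_pair_second_odd`), `φ_ȳ ≡ −φ_y (mod p)`.
`p`-adic valuations of rational numbers; nothing here concerns irrationality.
-/

noncomputable section

open Finset PowerSeries

namespace Summit.KontsevichZagierPeriods.Zeta5Search.SecondOrder

open Summit.KontsevichZagierPeriods.Zeta5Search.DualSeries (InBox)
open Summit.KontsevichZagierPeriods.Zeta5Search.WedgeDictionary (pfData)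
open Summit.KontsevichZagierPeriods.Zeta5Search.CasoratianValuation (InPolytope)
open Summit.KontsevichZagierPeriods.Zeta5Search.ClusterValuation
open Summit.KontsevichZagierPeriods.Zeta5Search.PadicSeries
open Summit.KontsevichZagierPeriods.Zeta5Search.CellA (classW padicNorm_pow_eq padicNorm_p gHat_conj)
open Summit.KontsevichZagierPeriods.Zeta5Search.LevelClass (level_mem)
open Summit.KontsevichZagierPeriods.Zeta5Search.BigPrime (padicNorm_mul_le_one)
open Summit.KontsevichZagierPeriods.Zeta5Search.CellKit (conj_level)

variable {p : ℕ} [hp : Fact p.Prime]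

/-! ## §1 Conjugation at odd exponent; the centre -/

section Conj

variable (b : ℕ → ℤ) (hb : InPolytope b) (hp5 : 5 ≤ p)
  {x L : ℕ} (hx : x < p) (hL : x + L * p ≤ (b 0).toNat) (hL' : (b 0).toNat < x + L * p + p)
include hb hp5 hx hL hL'

/-- **Conjugate unit at odd exponent, to second order**: `‖ĝ_x̄ − ĝ_x(1 − Lpφ_x)‖ ≤ p⁻²`. -/
theorem gHat_pair_second_odd (hc : ¬ CentreIn b p x) (hodd : Odd (classExp b p x)) :
    padicNorm p (gHat b p (conjClass b p x) - gHat b p x * (1 - (L : ℚ) * p * phiHat b p x)) ≤ (p : ℚ) ^ (-(2 : ℤ)) := by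
  have hq := level_mem b hx hL hL' le_rfl
  have hconj : conjClass b p x = (b 0).toNat - (x + L * p) := CellKit.conjClass_eq_level b hL hL'
  have hG2 := gHat_conj b p x (x + L * p) hb hp.out hp5 hx hc hq
  have hev : Even (classExp b p x + 1) := hodd.add_one
  rw [hev.neg_one_zpow, one_mul] at hG2
  have hS := padicNorm_gHat_sub_second_le b (by omega) hx hq
  rw [level_div hx] at hS
  rw [hconj, hG2]
  exact hS

/-- **`φ_x̄ ≡ −φ_x (mod p)`.** -/
theorem phi_pair_first : padicNorm p (phiHat b p (conjClass b p x) + phiHat b p x) ≤ (p : ℚ) ^ (-(1 : ℤ)) := by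
  have hp0 : (p : ℚ) ≠ 0 := Nat.cast_ne_zero.2 hp.out.ne_zero
  have hp2 : p ≠ 2 := by omega
  have h := phiHat_conj_second b hb hp5 hx hL hL'
  have e : phiHat b p (conjClass b p x) + phiHat b p x =
      (phiHat b p (conjClass b p x) + (phiHat b p x + (L : ℚ) * p * phi2Hat b p x)) - (L : ℚ) * p * phi2Hat b p x := by ring
  rw [e]
  refine (padicNorm.sub (p := p)).trans (max_le (h.trans (zpow_le_zpow_right₀ (by exact_mod_cast hp.out.one_le) (by norm_num))) ?_)
  rw [padicNorm.mul, padicNorm.mul, padicNorm_p]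
  have hL1 : padicNorm p (L : ℚ) ≤ 1 := by simpa using padicNorm.of_nat (p := p) L
  calc padicNorm p (L : ℚ) * (p : ℚ) ^ (-(1 : ℤ)) * padicNorm p (phi2Hat b p x)
      ≤ 1 * (p : ℚ) ^ (-(1 : ℤ)) * 1 :=
        mul_le_mul (mul_le_mul_of_nonneg_right hL1 (zpow_p_nonneg _)) (padicNorm_phi2Hat_le_one b hp2 x) (padicNorm.nonneg _)
          (mul_nonneg zero_le_one (zpow_p_nonneg _))
    _ = (p : ℚ) ^ (-(1 : ℤ)) := by ring

/-- **`φ_y ≡ 0 (mod p)` for a self-conjugate class.** -/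
theorem phiHat_centre_small (hpn : (p : ℤ) ≤ b 0) (hcen : CentreIn b p x) :
    padicNorm p (phiHat b p x) ≤ (p : ℚ) ^ (-(1 : ℤ)) := by
  have hpnN : p ≤ (b 0).toNat := by have := hb.1.1; omega
  have hself := (centreIn_iff_conjClass_eq b hpnN hx).1 hcen
  have h := phi_pair_first b hb hp5 hx hL hL'
  rw [hself, ← two_mul, padicNorm.mul, padicNorm_two (by omega), one_mul] at h
  exact h

end Conj

/-! ## §2 The algebra of the raise pair -/

/-- **The raise-pair bound** (generic): with `t = s₁ + s₁'`, `κt = s₂ − s₂' + Ms₁'`, `ĝ' ≡ ĝ(1 − Mpφ) (p²)`, `φ' ≡ −φ (p)`: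
`‖ĝ(s₁ − pφs₂) + ĝ'(s₁' − pφ's₂') − ĝ(1 − pκφ)t‖ ≤ p⁻²`. -/
theorem raisePair_bound {g g' φ φ' M κ s1 s2 s1' s2' t : ℚ} (hg : padicNorm p g ≤ 1) (hφ : padicNorm p φ ≤ 1)
    (hM : padicNorm p M ≤ 1) (hs1' : padicNorm p s1' ≤ 1) (hs2' : padicNorm p s2' ≤ 1)
    (hεg : padicNorm p (g' - g * (1 - M * p * φ)) ≤ (p : ℚ) ^ (-(2 : ℤ)))
    (hεφ : padicNorm p (φ' + φ) ≤ (p : ℚ) ^ (-(1 : ℤ))) (ht : s1 + s1' = t) (hκ : s2 - s2' + M * s1' = κ * t) :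
    padicNorm p (g * (s1 - (p : ℚ) * φ * s2) + g' * (s1' - (p : ℚ) * φ' * s2') - g * (1 - (p : ℚ) * κ * φ) * t) ≤
      (p : ℚ) ^ (-(2 : ℤ)) := by
  have hp0 : (p : ℚ) ≠ 0 := Nat.cast_ne_zero.2 hp.out.ne_zero
  have hp1 : padicNorm p (p : ℚ) ≤ 1 := padicNorm_p_le_one
  have hpn : padicNorm p (p : ℚ) = (p : ℚ) ^ (-(1 : ℤ)) := padicNorm_p
  set εg := g' - g * (1 - M * p * φ) with hεgdef
  set εφ := φ' + φ with hεφdef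
  have hg' : g' = εg + g * (1 - M * p * φ) := by rw [hεgdef]; ring
  have hφ' : φ' = εφ - φ := by rw [hεφdef]; ring
  have hs1 : s1 = t - s1' := by rw [← ht]; ring
  have hs2 : s2 = κ * t + s2' - M * s1' := by rw [← hκ]; ring
  have e : g * (s1 - (p : ℚ) * φ * s2) + g' * (s1' - (p : ℚ) * φ' * s2') - g * (1 - (p : ℚ) * κ * φ) * t =
      εg * (s1' - (p : ℚ) * (εφ - φ) * s2') - (p : ℚ) * (g * (εφ * s2')) + (p : ℚ) ^ 2 * (M * g * φ * (εφ - φ) * s2') := by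
    rw [hg', hφ', hs1, hs2]; ring
  rw [e]
  have hεφ1 : padicNorm p εφ ≤ 1 := hεφ.trans (zpow_le_one_of_nonpos₀ (by exact_mod_cast hp.out.one_le) (by norm_num))
  have hd : padicNorm p (εφ - φ) ≤ 1 := (padicNorm.sub (p := p)).trans (max_le hεφ1 hφ)
  refine (padicNorm.nonarchimedean (p := p)).trans (max_le ((padicNorm.sub (p := p)).trans (max_le ?_ ?_)) ?_)
  · exact padicNorm_mul_le_left hεg ((padicNorm.sub (p := p)).trans (max_le hs1'
      (padicNorm_mul_le_one (padicNorm_mul_le_one hp1 hd) hs2')))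
  · rw [padicNorm.mul, hpn, padicNorm.mul]
    calc (p : ℚ) ^ (-(1 : ℤ)) * (padicNorm p g * padicNorm p (εφ * s2'))
        ≤ (p : ℚ) ^ (-(1 : ℤ)) * (1 * (p : ℚ) ^ (-(1 : ℤ))) :=
          mul_le_mul_of_nonneg_left (mul_le_mul hg (padicNorm_mul_le_left hεφ hs2') (padicNorm.nonneg _) zero_le_one)
            (zpow_p_nonneg _)
      _ = (p : ℚ) ^ (-(2 : ℤ)) := by rw [one_mul, ← zpow_add₀ hp0]; norm_num
  · exact (padicNorm_p_pow_mul_le 2 (padicNorm_mul_le_one (padicNorm_mul_le_one (padicNorm_mul_le_one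
      (padicNorm_mul_le_one hM hg) hφ) hd) hs2')).trans (by rw [mul_one]; norm_num)

/-! ## §3 The raise pair identity (P1) -/

section Raise

variable (b : ℕ → ℤ) (hb : InPolytope b) (hp5 : 5 ≤ p) (hpn : (p : ℤ) ≤ b 0) (hwin : (b 0 + 2 : ℤ) < (p : ℤ) ^ 2)
  {T : List ℤ} (hT : T.reverse = T) {y : ℕ} (hy : y < p) (hpole : 1 ≤ classPoleCount b p y)
  {m : ℤ} (hme : Even m) (hE : classExp b p y = m + 1) (hm : m + 1 ≤ -2)
include hb hp5 hpn hwin hT hy hpole hme hE hm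

/-- **P1 — the RAISE PAIR to relative order `p²`.**  `(Ω,N)_y + (Ω,N)_ȳ ≡ a·(τ_W, τ_V)(T) (mod p³)` with `‖aτ‖ ≤ p⁻¹`. -/
theorem raise_pair₃
    (h4 : isRaise T (classTypeList b p y) = true ∨ (¬ (2 : ℤ) ∣ b 0 ∧ CentreIn b p y ∧ classTypeList b p y = T)) :
    ∃ a : ℚ, (padicNorm p (a * typeTauW (tTop T) (tList T)) ≤ (p : ℚ) ^ (-(1 : ℤ)) ∧
        padicNorm p (a * typeTauV (tTop T) (tList T)) ≤ (p : ℚ) ^ (-(1 : ℤ))) ∧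
      padicNorm p (classW b p y / (-(p : ℚ)) ^ (m + 3) + classW b p (conjClass b p y) / (-(p : ℚ)) ^ (m + 3)
        - a * typeTauW (tTop T) (tList T)) ≤ (p : ℚ) ^ (-(3 : ℤ)) ∧
      padicNorm p (classV b p y / (-(p : ℚ)) ^ m + classV b p (conjClass b p y) / (-(p : ℚ)) ^ m
        - a * typeTauV (tTop T) (tList T)) ≤ (p : ℚ) ^ (-(3 : ℤ)) := by
  have h0 : 0 ≤ b 0 := hb.1.1
  have hp0 : (p : ℚ) ≠ 0 := Nat.cast_ne_zero.2 hp.out.ne_zero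
  have hp2 : p ≠ 2 := by omega
  have hpn1 : padicNorm p (p : ℚ) = (p : ℚ) ^ (-(1 : ℤ)) := padicNorm_p
  obtain ⟨-, -, -, hn⟩ := thmA_data b hb hwin
  have hpnN : p ≤ (b 0).toNat := by have := hb.1.1; omega
  have hyn := le_b0_of_lt b hpn hy
  obtain ⟨hL, hL'⟩ := level_bounds' (p := p) b hyn
  set M := topLevel b p y with hMdef
  obtain ⟨hy', hM2, hM2'⟩ := conj_level b hy hL hL'
  have hEc : classExp b p (conjClass b p y) = m + 1 := by rw [classExp_conj b h0 hyn]; exact hE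
  have hpolec : 1 ≤ classPoleCount b p (conjClass b p y) := by rw [classPoleCount_conj b h0 hyn]; exact hpole
  have hneg : classExp b p y < 0 := by omega
  -- (W2)/(V2) for both classes
  have hWy := sub3W_norm b hb hp5 hwin hy hpole hE
  have hWc := sub3W_norm b hb hp5 hwin hy' hpolec hEc
  have hVy := sub3V_norm b hb hp5 hwin hy hpole hE (by omega)
  have hVc := sub3V_norm b hb hp5 hwin hy' hpolec hEc (by omega)
  -- first-order live pair
  obtain ⟨htW, htV⟩ := live_pair b hb hpn hT hy hpole hneg h4
  -- norms
  have hg1 : padicNorm p (gHat b p y) ≤ 1 := padicNorm_gHat_le_one' b hp5 y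
  have hφ1 : padicNorm p (phiHat b p y) ≤ 1 := padicNorm_phiHat_le_one b hp2 y
  have hw1 : ∀ z, padicNorm p (wHat b p z) ≤ 1 := fun z => LevelClass.padicNorm_wHat_le_one b h0 hn hp2 z
  have hv1 : ∀ z, padicNorm p (vHat b p z) ≤ 1 := fun z => (LevelClass.padicNorm_vHat_le_one b h0 hn hp2 : padicNorm p (vHat b p z) ≤ 1)
  have hw21 : ∀ z, padicNorm p (wHat2 b p z) ≤ 1 := fun z => padicNorm_wHat2_le_one b h0 hn hp2 z
  have hv21 : ∀ z, padicNorm p (vHat2 b p z) ≤ 1 := fun z => padicNorm_vHat2_le_one b h0 hn hp2 z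
  have hM1 : padicNorm p (M : ℚ) ≤ 1 := by simpa using padicNorm.of_nat (p := p) M
  -- the common final step: `Ω_y + Ω_ȳ − aτ = [digit errors] − p·[pair defect]`
  have final : ∀ {Wy Wc s t a D : ℚ} (sy sc : ℚ), padicNorm p (Wy + (p : ℚ) * sy) ≤ (p : ℚ) ^ (-(3 : ℤ)) →
      padicNorm p (Wc + (p : ℚ) * sc) ≤ (p : ℚ) ^ (-(3 : ℤ)) → a = -(p : ℚ) * D → sy + sc - D * t = s →
      padicNorm p s ≤ (p : ℚ) ^ (-(2 : ℤ)) → padicNorm p (Wy + Wc - a * t) ≤ (p : ℚ) ^ (-(3 : ℤ)) := by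
    intro Wy Wc s t a D sy sc h1 h2 ha hs hsn
    have e : Wy + Wc - a * t = (Wy + (p : ℚ) * sy) + (Wc + (p : ℚ) * sc) - (p : ℚ) * s := by rw [ha, ← hs]; ring
    rw [e]
    refine (padicNorm.sub (p := p)).trans (max_le ((padicNorm.nonarchimedean (p := p)).trans (max_le h1 h2)) ?_)
    rw [padicNorm.mul, hpn1]
    calc (p : ℚ) ^ (-(1 : ℤ)) * padicNorm p s ≤ (p : ℚ) ^ (-(1 : ℤ)) * (p : ℚ) ^ (-(2 : ℤ)) :=
          mul_le_mul_of_nonneg_left hsn (zpow_p_nonneg _)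
      _ = (p : ℚ) ^ (-(3 : ℤ)) := by rw [← zpow_add₀ hp0]; norm_num
  rcases h4 with hr | ⟨hodd, hcen, htl⟩
  · -- Case A: a single raise of `T`
    obtain ⟨κ, hκW, hκV⟩ := live_pair₂ b hb hpn hT hy hpole (by omega) hr
    have hκ1 : padicNorm p (κ : ℚ) ≤ 1 := padicNorm.of_int κ
    -- `ĝ_ȳ ≡ ĝ_y(1 − pMφ_y) (mod p²)` and `φ_ȳ ≡ −φ_y (mod p)`, also in the self-conjugate case
    have hεg : padicNorm p (gHat b p (conjClass b p y) - gHat b p y * (1 - (M : ℚ) * p * phiHat b p y)) ≤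
        (p : ℚ) ^ (-(2 : ℤ)) := by
      by_cases hc : CentreIn b p y
      · have hself := (centreIn_iff_conjClass_eq b hpnN hy).1 hc
        have hφs := phiHat_centre_small b hb hp5 hy hL hL' hpn hc
        rw [hself, show gHat b p y - gHat b p y * (1 - (M : ℚ) * p * phiHat b p y) =
          (p : ℚ) * ((M : ℚ) * gHat b p y * phiHat b p y) by ring, padicNorm.mul, hpn1]
        calc (p : ℚ) ^ (-(1 : ℤ)) * padicNorm p ((M : ℚ) * gHat b p y * phiHat b p y)
            ≤ (p : ℚ) ^ (-(1 : ℤ)) * (p : ℚ) ^ (-(1 : ℤ)) :=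
              mul_le_mul_of_nonneg_left (padicNorm_mul_le_right (padicNorm_mul_le_one hM1 hg1) hφs) (zpow_p_nonneg _)
          _ = (p : ℚ) ^ (-(2 : ℤ)) := by rw [← zpow_add₀ hp0]; norm_num
      · have hodd : Odd (classExp b p y) := by rw [hE]; exact hme.add_one
        exact gHat_pair_second_odd b hb hp5 hy hL hL' hc hodd
    have hεφ : padicNorm p (phiHat b p (conjClass b p y) + phiHat b p y) ≤ (p : ℚ) ^ (-(1 : ℤ)) :=
      phi_pair_first b hb hp5 hy hL hL'
    have ha : padicNorm p (-(p : ℚ) * (gHat b p y * (1 - (p : ℚ) * κ * phiHat b p y))) ≤ (p : ℚ) ^ (-(1 : ℤ)) := by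
      rw [padicNorm.mul, padicNorm.neg, hpn1]
      have : padicNorm p (gHat b p y * (1 - (p : ℚ) * κ * phiHat b p y)) ≤ 1 :=
        padicNorm_mul_le_one hg1 ((padicNorm.sub (p := p)).trans (max_le (by rw [padicNorm.one])
          (padicNorm_mul_le_one (padicNorm_mul_le_one padicNorm_p_le_one hκ1) hφ1)))
      calc (p : ℚ) ^ (-(1 : ℤ)) * _ ≤ (p : ℚ) ^ (-(1 : ℤ)) * 1 := mul_le_mul_of_nonneg_left this (zpow_p_nonneg _)
        _ = (p : ℚ) ^ (-(1 : ℤ)) := mul_one _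
    refine ⟨-(p : ℚ) * (gHat b p y * (1 - (p : ℚ) * κ * phiHat b p y)), ⟨?_, ?_⟩, ?_, ?_⟩
    · rw [← htW]; exact padicNorm_mul_le_left ha ((padicNorm.nonarchimedean (p := p)).trans (max_le (hw1 _) (hw1 _)))
    · rw [← htV]; exact padicNorm_mul_le_left ha ((padicNorm.nonarchimedean (p := p)).trans (max_le (hv1 _) (hv1 _)))
    · exact final _ _ hWy hWc rfl (by ring)
        (raisePair_bound (p := p) hg1 hφ1 hM1 (hw1 _) (hw21 _) hεg hεφ htW hκW)
    · exact final _ _ hVy hVc rfl (by ring)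
        (raisePair_bound (p := p) hg1 hφ1 hM1 (hv1 _) (hv21 _) hεg hεφ htV hκV)
  · -- Case B: the odd-centre class, `ȳ = y`, `φ_y ≡ 0`
    have hself : conjClass b p y = y := (centreIn_iff_conjClass_eq b hpnN hy).1 hcen
    have hφs := phiHat_centre_small b hb hp5 hy hL hL' hpn hcen
    rw [hself] at htW htV hWc hVc
    have ha : padicNorm p (-(p : ℚ) * gHat b p y) ≤ (p : ℚ) ^ (-(1 : ℤ)) := by
      rw [padicNorm.mul, padicNorm.neg, hpn1]
      calc (p : ℚ) ^ (-(1 : ℤ)) * _ ≤ (p : ℚ) ^ (-(1 : ℤ)) * 1 := mul_le_mul_of_nonneg_left hg1 (zpow_p_nonneg _)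
        _ = (p : ℚ) ^ (-(1 : ℤ)) := mul_one _
    refine ⟨-(p : ℚ) * gHat b p y, ⟨?_, ?_⟩, ?_, ?_⟩
    · rw [← htW]; exact padicNorm_mul_le_left ha ((padicNorm.nonarchimedean (p := p)).trans (max_le (hw1 _) (hw1 _)))
    · rw [← htV]; exact padicNorm_mul_le_left ha ((padicNorm.nonarchimedean (p := p)).trans (max_le (hv1 _) (hv1 _)))
    · rw [hself]
      have e : gHat b p y * (wHat b p y - (p : ℚ) * phiHat b p y * wHat2 b p y)
          + gHat b p y * (wHat b p y - (p : ℚ) * phiHat b p y * wHat2 b p y) - gHat b p y * typeTauW (tTop T) (tList T) =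
          -(p : ℚ) * (2 * (gHat b p y * (phiHat b p y * wHat2 b p y))) := by rw [← htW]; ring
      refine final _ _ hWy hWc rfl e ?_
      rw [padicNorm.mul, padicNorm.neg, hpn1, padicNorm.mul, padicNorm_two hp2, one_mul]
      calc (p : ℚ) ^ (-(1 : ℤ)) * _ ≤ (p : ℚ) ^ (-(1 : ℤ)) * (p : ℚ) ^ (-(1 : ℤ)) :=
            mul_le_mul_of_nonneg_left (padicNorm_mul_le_right hg1 (padicNorm_mul_le_left hφs (hw21 y))) (zpow_p_nonneg _)
        _ = (p : ℚ) ^ (-(2 : ℤ)) := by rw [← zpow_add₀ hp0]; norm_num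
    · rw [hself]
      have e : gHat b p y * (vHat b p y - (p : ℚ) * phiHat b p y * vHat2 b p y)
          + gHat b p y * (vHat b p y - (p : ℚ) * phiHat b p y * vHat2 b p y) - gHat b p y * typeTauV (tTop T) (tList T) =
          -(p : ℚ) * (2 * (gHat b p y * (phiHat b p y * vHat2 b p y))) := by rw [← htV]; ring
      refine final _ _ hVy hVc rfl e ?_
      rw [padicNorm.mul, padicNorm.neg, hpn1, padicNorm.mul, padicNorm_two hp2, one_mul]
      calc (p : ℚ) ^ (-(1 : ℤ)) * _ ≤ (p : ℚ) ^ (-(1 : ℤ)) * (p : ℚ) ^ (-(1 : ℤ)) :=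
            mul_le_mul_of_nonneg_left (padicNorm_mul_le_right hg1 (padicNorm_mul_le_left hφs (hv21 y))) (zpow_p_nonneg _)
        _ = (p : ℚ) ^ (-(2 : ℤ)) := by rw [← zpow_add₀ hp0]; norm_num

end Raise

end Summit.KontsevichZagierPeriods.Zeta5Search.SecondOrder

end
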